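import Mathlib

/-!
# Route `FilamentSkeletonRss` · crux `SelectionBoxRJ` (stmt-NavierStokesRegularity-21220) — rung tools:
# a `C¹` cut-off with an EXPLICIT derivative bound

Lane `ns-filament-19175-p1` (g7); helper file `--supports stmt-NavierStokesRegularity-21220`, route-independent.

`…RungModelArcTools.exists_smooth_cutoff` gives a smooth plateau cut-off but no bound on its derivative.  The true-kernel
rung needs the `C^{2,1}` modulus of the arc, hence `sup |χ′|`.  Here: the `C¹` transition
`P(x) = ∫₀ˣ 6·max(0, s(1−s)) ds` (`= 3x² − 2x³` on `[0,1]`, `0` below, `1` above, `0 ≤ P′ ≤ 3/2`) and the cut-off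
`χ(t) = P((S₂ − t)/(S₂ − S₁))·P((S₂ + t)/(S₂ − S₁))`:

* `transition_hasDerivAt`, `transition_of_nonpos`, `transition_of_one_le`, `transition_nonneg`, `transition_le_one`;
* `exists_cutoff_deriv` — for `S₁ < S₂` there is `χ : ℝ → ℝ`, `C¹`, `= 1` on `|t| ≤ S₁`, `= 0` on `|t| ≥ S₂`, values in
  `[0, 1]`, with `|χ′| ≤ 3/(S₂ − S₁)` everywhere.

HONEST FRAMING.  Elementary calculus for the rung ladder of a HYPOTHETICAL filament box; nothing here is a claim about
Navier–Stokes regularity or blow-up.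
-/

set_option linter.dupNamespace false -- `Theorems.…Theorems`-style path/namespace repetition is the tree convention

noncomputable section

namespace Summit.NavierStokesRegularity.NavierStokesRegularity.Theorems

open Set Function Filter Real MeasureTheory intervalIntegral
open scoped Topology

namespace SelectionBoxRJRung

/-- `φ` is continuous. [folklore] -/
theorem transitionDensity_continuous : Continuous (fun s : ℝ => 6 * max 0 (s * (1 - s))) := by
  fun_prop

/-- `0 ≤ φ ≤ 3/2`. [folklore] -/
theorem transitionDensity_bounds (s : ℝ) : 0 ≤ 6 * max 0 (s * (1 - s)) ∧ 6 * max 0 (s * (1 - s)) ≤ 3 / 2 := by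
  refine ⟨by positivity, ?_⟩
  have : max 0 (s * (1 - s)) ≤ 1 / 4 := max_le (by norm_num) (by nlinarith [sq_nonneg (s - 1 / 2)])
  linarith

/-- `φ = 0` off `(0, 1)`. [folklore] -/
theorem transitionDensity_eq_zero {s : ℝ} (hs : s ≤ 0 ∨ 1 ≤ s) : 6 * max 0 (s * (1 - s)) = 0 := by
  have : s * (1 - s) ≤ 0 := by
    rcases hs with h | h
    · nlinarith
    · nlinarith
  rw [max_eq_left this, mul_zero]

/-- `P′ = φ` everywhere. [folklore] -/
theorem transition_hasDerivAt (x : ℝ) :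
    HasDerivAt (fun x : ℝ => ∫ s in (0:ℝ)..x, 6 * max 0 (s * (1 - s))) (6 * max 0 (x * (1 - x))) x := by
  have h := transitionDensity_continuous.integral_hasStrictDerivAt 0 x
  exact h.hasDerivAt

/-- `P` is differentiable with `deriv P = φ`. [folklore] -/
theorem transition_deriv :
    deriv (fun x : ℝ => ∫ s in (0:ℝ)..x, 6 * max 0 (s * (1 - s))) = (fun s : ℝ => 6 * max 0 (s * (1 - s))) :=
  funext fun x => (transition_hasDerivAt x).deriv

/-- `P` is `C¹`. [folklore] -/
theorem transition_contDiff : ContDiff ℝ 1 (fun x : ℝ => ∫ s in (0:ℝ)..x, 6 * max 0 (s * (1 - s))) := by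
  rw [contDiff_one_iff_deriv]
  exact ⟨fun x => (transition_hasDerivAt x).differentiableAt, by rw [transition_deriv]; exact transitionDensity_continuous⟩

/-- `P x = 0` for `x ≤ 0`. [folklore] -/
theorem transition_of_nonpos {x : ℝ} (hx : x ≤ 0) : (∫ s in (0:ℝ)..x, 6 * max 0 (s * (1 - s))) = 0 := by
  rw [integral_congr (g := fun _ => (0:ℝ)) (fun s hs => ?_), intervalIntegral.integral_zero]
  rw [uIcc_of_ge hx] at hs
  exact transitionDensity_eq_zero (Or.inl hs.2)

/-- `P x = 1` for `1 ≤ x`. [folklore] -/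
theorem transition_of_one_le {x : ℝ} (hx : 1 ≤ x) : (∫ s in (0:ℝ)..x, 6 * max 0 (s * (1 - s))) = 1 := by
  have hi : IntervalIntegrable (fun s : ℝ => 6 * max 0 (s * (1 - s))) volume 0 1 :=
    transitionDensity_continuous.intervalIntegrable _ _
  have hi' : IntervalIntegrable (fun s : ℝ => 6 * max 0 (s * (1 - s))) volume 1 x :=
    transitionDensity_continuous.intervalIntegrable _ _
  rw [← integral_add_adjacent_intervals hi hi']
  have h1 : (∫ s in (0:ℝ)..1, 6 * max 0 (s * (1 - s))) = 1 := by
    rw [integral_congr (g := fun s => 6 * s - 6 * s ^ 2) (fun s hs => ?_)]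
    · have hF : ∀ s : ℝ, HasDerivAt (fun s : ℝ => 3 * s ^ 2 - 2 * s ^ 3) (6 * s - 6 * s ^ 2) s := fun s => by
        have h2 : HasDerivAt (fun y : ℝ => 3 * y ^ 2) (3 * (↑(2:ℕ) * s ^ (2 - 1))) s := (hasDerivAt_pow 2 s).const_mul 3
        have h3 : HasDerivAt (fun y : ℝ => 2 * y ^ 3) (2 * (↑(3:ℕ) * s ^ (3 - 1))) s := (hasDerivAt_pow 3 s).const_mul 2
        have h1 : HasDerivAt (fun y : ℝ => 3 * y ^ 2 - 2 * y ^ 3)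
            (3 * (↑(2:ℕ) * s ^ (2 - 1)) - 2 * (↑(3:ℕ) * s ^ (3 - 1))) s := h2.sub h3
        convert h1 using 1
        norm_num; ring
      rw [integral_eq_sub_of_hasDerivAt (fun s _ => hF s) ((by fun_prop : Continuous fun s : ℝ =>
        6 * s - 6 * s ^ 2).intervalIntegrable _ _)]
      norm_num
    · rw [uIcc_of_le zero_le_one] at hs
      dsimp only
      rw [max_eq_right (by nlinarith [hs.1, hs.2])]; ring
  have h2 : (∫ s in (1:ℝ)..x, 6 * max 0 (s * (1 - s))) = 0 := by
    rw [integral_congr (g := fun _ => (0:ℝ)) (fun s hs => ?_), intervalIntegral.integral_zero]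
    rw [uIcc_of_le hx] at hs
    exact transitionDensity_eq_zero (Or.inr hs.1)
  rw [h1, h2, add_zero]

/-- `P` is monotone. [folklore] -/
theorem transition_monotone : Monotone (fun x : ℝ => ∫ s in (0:ℝ)..x, 6 * max 0 (s * (1 - s))) :=
  monotone_of_deriv_nonneg (fun x => (transition_hasDerivAt x).differentiableAt)
    fun x => by rw [transition_deriv]; exact (transitionDensity_bounds x).1

/-- `0 ≤ P`. [folklore] -/
theorem transition_nonneg (x : ℝ) : 0 ≤ ∫ s in (0:ℝ)..x, 6 * max 0 (s * (1 - s)) := by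
  rcases le_or_gt x 0 with h | h
  · rw [transition_of_nonpos h]
  · have h0 : (∫ s in (0:ℝ)..0, 6 * max 0 (s * (1 - s))) = 0 := transition_of_nonpos le_rfl
    have hm := transition_monotone h.le
    dsimp only at hm
    linarith

/-- `P ≤ 1`. [folklore] -/
theorem transition_le_one (x : ℝ) : (∫ s in (0:ℝ)..x, 6 * max 0 (s * (1 - s))) ≤ 1 := by
  rcases le_or_gt 1 x with h | h
  · rw [transition_of_one_le h]
  · have h1 : (∫ s in (0:ℝ)..1, 6 * max 0 (s * (1 - s))) = 1 := transition_of_one_le le_rfl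
    have hm := transition_monotone h.le
    dsimp only at hm
    linarith

/-- **A `C¹` plateau cut-off with explicit derivative bound.**  For `S₁ < S₂`: `χ` is `C¹`, `χ = 1` on `|t| ≤ S₁`,
`χ = 0` on `|t| ≥ S₂`, `0 ≤ χ ≤ 1`, and `|χ′| ≤ 3/(S₂ − S₁)`. [folklore] -/
theorem exists_cutoff_deriv {S₁ S₂ : ℝ} (h : S₁ < S₂) :
    ∃ χ : ℝ → ℝ, ContDiff ℝ 1 χ ∧ (∀ t, |t| ≤ S₁ → χ t = 1) ∧ (∀ t, S₂ ≤ |t| → χ t = 0) ∧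
      (∀ t, 0 ≤ χ t) ∧ (∀ t, χ t ≤ 1) ∧ (∀ t, |deriv χ t| ≤ 3 / (S₂ - S₁)) := by
  have hd : 0 < S₂ - S₁ := sub_pos.2 h
  set d : ℝ := S₂ - S₁ with hdd
  refine ⟨fun t => (∫ s in (0:ℝ)..(S₂ - t) / d, 6 * max 0 (s * (1 - s))) * (∫ s in (0:ℝ)..(S₂ + t) / d, 6 * max 0 (s * (1 - s))),
    ?_, fun t ht => ?_, fun t ht => ?_, fun t => ?_, fun t => ?_, fun t => ?_⟩
  · have h1 : ContDiff ℝ 1 (fun t : ℝ => (S₂ - t) / d) := by fun_prop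
    have h2 : ContDiff ℝ 1 (fun t : ℝ => (S₂ + t) / d) := by fun_prop
    exact (transition_contDiff.comp h1).mul (transition_contDiff.comp h2)
  · have ht' := abs_le.1 ht
    have h1 : 1 ≤ (S₂ - t) / d := by rw [le_div_iff₀ hd]; linarith
    have h2 : 1 ≤ (S₂ + t) / d := by rw [le_div_iff₀ hd]; linarith
    simp only [transition_of_one_le h1, transition_of_one_le h2, mul_one]
  · rcases le_abs'.1 ht with h1 | h1
    · have : (S₂ + t) / d ≤ 0 := div_nonpos_of_nonpos_of_nonneg (by linarith) hd.le
      simp only [transition_of_nonpos this, mul_zero]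
    · have : (S₂ - t) / d ≤ 0 := div_nonpos_of_nonpos_of_nonneg (by linarith) hd.le
      simp only [transition_of_nonpos this, zero_mul]
  · exact mul_nonneg (transition_nonneg _) (transition_nonneg _)
  · exact mul_le_one₀ (transition_le_one _) (transition_nonneg _) (transition_le_one _)
  · have ha : HasDerivAt (fun t : ℝ => (S₂ - t) / d) (-1 / d) t := by
      have := ((hasDerivAt_id t).const_sub S₂).div_const d
      simpa using this
    have hb : HasDerivAt (fun t : ℝ => (S₂ + t) / d) (1 / d) t := by
      have := ((hasDerivAt_id t).const_add S₂).div_const d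
      simpa using this
    have hA0 := (transition_hasDerivAt ((S₂ - t) / d)).comp t ha
    have hA : HasDerivAt (fun t : ℝ => (∫ s in (0:ℝ)..(S₂ - t) / d, 6 * max 0 (s * (1 - s)))) ((6 * max 0 ((S₂ - t) / d * (1 - (S₂ - t) / d))) * (-1 / d)) t :=
      hA0
    have hB0 := (transition_hasDerivAt ((S₂ + t) / d)).comp t hb
    have hB : HasDerivAt (fun t : ℝ => (∫ s in (0:ℝ)..(S₂ + t) / d, 6 * max 0 (s * (1 - s)))) ((6 * max 0 ((S₂ + t) / d * (1 - (S₂ + t) / d))) * (1 / d)) t :=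
      hB0
    have hprod : HasDerivAt (fun t : ℝ => (∫ s in (0:ℝ)..(S₂ - t) / d, 6 * max 0 (s * (1 - s))) * (∫ s in (0:ℝ)..(S₂ + t) / d, 6 * max 0 (s * (1 - s))))
        ((6 * max 0 ((S₂ - t) / d * (1 - (S₂ - t) / d))) * (-1 / d) * (∫ s in (0:ℝ)..(S₂ + t) / d, 6 * max 0 (s * (1 - s))) +
          (∫ s in (0:ℝ)..(S₂ - t) / d, 6 * max 0 (s * (1 - s))) * ((6 * max 0 ((S₂ + t) / d * (1 - (S₂ + t) / d))) * (1 / d))) t := hA.mul hB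
    rw [hprod.deriv]
    obtain ⟨hφa0, hφa⟩ := transitionDensity_bounds ((S₂ - t) / d)
    obtain ⟨hφb0, hφb⟩ := transitionDensity_bounds ((S₂ + t) / d)
    have hPa0 := transition_nonneg ((S₂ - t) / d)
    have hPa1 := transition_le_one ((S₂ - t) / d)
    have hPb0 := transition_nonneg ((S₂ + t) / d)
    have hPb1 := transition_le_one ((S₂ + t) / d)
    have hd1 : 0 < 1 / d := by positivity
    rw [abs_le]
    constructor
    · have h1 : (6 * max 0 ((S₂ - t) / d * (1 - (S₂ - t) / d))) * (-1 / d) * (∫ s in (0:ℝ)..(S₂ + t) / d, 6 * max 0 (s * (1 - s))) ≥ -(3 / 2 * (1 / d)) := by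
        have : (6 * max 0 ((S₂ - t) / d * (1 - (S₂ - t) / d))) * (∫ s in (0:ℝ)..(S₂ + t) / d, 6 * max 0 (s * (1 - s))) ≤ 3 / 2 * 1 :=
          mul_le_mul hφa hPb1 hPb0 (by norm_num)
        have h' : (6 * max 0 ((S₂ - t) / d * (1 - (S₂ - t) / d))) * (-1 / d) * (∫ s in (0:ℝ)..(S₂ + t) / d, 6 * max 0 (s * (1 - s))) =
            -(((6 * max 0 ((S₂ - t) / d * (1 - (S₂ - t) / d))) * (∫ s in (0:ℝ)..(S₂ + t) / d, 6 * max 0 (s * (1 - s)))) * (1 / d)) := by ring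
        rw [h']; nlinarith
      have h2 : 0 ≤ (∫ s in (0:ℝ)..(S₂ - t) / d, 6 * max 0 (s * (1 - s))) * ((6 * max 0 ((S₂ + t) / d * (1 - (S₂ + t) / d))) * (1 / d)) := by positivity
      have : 3 / 2 * (1 / d) ≤ 3 / d := by
        rw [show 3 / d = 3 * (1 / d) by ring]; nlinarith [hd1]
      linarith
    · have h1 : (6 * max 0 ((S₂ - t) / d * (1 - (S₂ - t) / d))) * (-1 / d) * (∫ s in (0:ℝ)..(S₂ + t) / d, 6 * max 0 (s * (1 - s))) ≤ 0 := by
        have : 0 ≤ (6 * max 0 ((S₂ - t) / d * (1 - (S₂ - t) / d))) * (1 / d) * (∫ s in (0:ℝ)..(S₂ + t) / d, 6 * max 0 (s * (1 - s))) := by positivity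
        have h' : (6 * max 0 ((S₂ - t) / d * (1 - (S₂ - t) / d))) * (-1 / d) * (∫ s in (0:ℝ)..(S₂ + t) / d, 6 * max 0 (s * (1 - s))) =
            -((6 * max 0 ((S₂ - t) / d * (1 - (S₂ - t) / d))) * (1 / d) * (∫ s in (0:ℝ)..(S₂ + t) / d, 6 * max 0 (s * (1 - s)))) := by ring
        rw [h']; linarith
      have h2 : (∫ s in (0:ℝ)..(S₂ - t) / d, 6 * max 0 (s * (1 - s))) * ((6 * max 0 ((S₂ + t) / d * (1 - (S₂ + t) / d))) * (1 / d)) ≤ 3 / 2 * (1 / d) := by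
        calc (∫ s in (0:ℝ)..(S₂ - t) / d, 6 * max 0 (s * (1 - s))) * ((6 * max 0 ((S₂ + t) / d * (1 - (S₂ + t) / d))) * (1 / d))
            ≤ 1 * (3 / 2 * (1 / d)) :=
              mul_le_mul hPa1 (mul_le_mul_of_nonneg_right hφb hd1.le) (by positivity) zero_le_one
          _ = 3 / 2 * (1 / d) := one_mul _
      have : 3 / 2 * (1 / d) ≤ 3 / d := by
        rw [show 3 / d = 3 * (1 / d) by ring]; nlinarith
      linarith
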